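import Mathlib
import HarnessLib
import HarnessLib.Audit
import Summits.CriticalPhenomena.Statement
import Literature.Probability.Percolation.CriticalContinuity
import Literature.Probability.Percolation.BondPercolationSymmetry
import Literature.Probability.LatticeModels.ThermodynamicLimit

/-!
Route: PercDustRigidity

# Route PercDustRigidity — FKG dust rigidity — stationarity + association + finite energy forbid a
giant killed by a density-zero dust of isolated edges; Bernoulli(p_c) passes the dust test (AG +
sharpness), so θ(p_c) = 0

It suffices to show X = DustRigidity (FKG DUST RIGIDITY): every probability measure μ on bond
configurations of ℤ³ that is supported on
lattice configurations, translation-invariant, ℤ³-ergodic, insertion- and deletion-tolerant (finite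
energy), ergodic under every non-zero
shift, invariant under all lattice automorphisms, positively associated, with a.s. finite clusters
in every coordinate half-space — the
exact hypothesis list of FKGHalfSpaceRigidity (route PercPotemkinWeaver) — AND which is
DUST-FRAGILE: for some density-zero set S of
level-1 plug-sieve edges (S ⊆ D₁ = {vertical edge {x, x+e₃} : x ∈ 2ℤ³}, |S ∩ E(Λ_n)|/|E(Λ_n)| → 0)
μ-a.s. every cluster of ω ∖ S is finite,
does not percolate: μ(|C(0)| = ∞) = 0. X is FKGHalfSpaceRigidity weakened by one more compliance
hypothesis, so FKGHalfSpaceRigidity → X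
(Sketch2.lean, one line). Bernoulli(p_c) on ℤ³ satisfies every hypothesis: the soft portrait
(BernoulliStationaryPortrait ∧ BernoulliEnergyFKGPortrait = PercPotemkinWeaver's
BernoulliSoftPortrait verbatim,
split in two for the 4000-char item cap; provable now; half-space finiteness =
BarskyGrimmettNewman1991, PROVED in tree) and — the content of idea card
dust-sandwich-continuity, now LOAD-BEARING — dust-fragility at p_c (DustDeathOfStrictDiminishment:
Aizenman–Grimmett strictness for the plug
sieves, crux PlugSieveStrictDiminishment, + PROVED quasi-transitive sharpness + Borel–Cantelli over
radially thinning shells). Hence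
X → θ(p_c) = 0; the deciding theorem `closes : BernoulliStationaryPortrait →
BernoulliEnergyFKGPortrait → PlugSieveStrictDiminishment →
DustDeathOfStrictDiminishment → DustRigidity → _root_.PercolationContinuityZ3` is PROVED in
glue.lean (Sketch3.lean rc 0, no sorry). Dichotomy: either X is proved (and the conjunct
with it) or ¬X exhibits an FKG Potemkin weaver that is moreover killed by one fixed density-zero
matching — a far more constrained monster
than PercPotemkinWeaver's, and the sharpest form of the card's sandwich moral "a proof for ℤ³ must
use stationarity exactly where the dust
lives". This route SUPERSEDES the retired barrier route PercDustSandwich (D-0027 §2.1 audit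
2026-08-15: its assembly concluded the barrier
target; file kept as record; items stmt-CriticalPhenomena-7140/7142/7143 are re-wanted here by
signature).
Lean: `∀ μ : MeasureTheory.Measure (Literature.Probability.Percolation.BondConfig
(Literature.Probability.LatticeModels.Site 3)), MeasureTheory.IsProbabilityMeasure μ → (∀ᵐ ω ∂μ, ω ⊆
(Literature.Probability.LatticeModels.zdGraph 3).edgeSet) → (∀ (v :
Literature.Probability.LatticeModels.Site 3) (S : Set (Literature.Probability.Percolation.BondConfig
(Literature.Probability.LatticeModels.Site 3))), MeasurableSet S → μ
(Literature.Probability.Percolation.BondConfig.relabel (Literature.Probability.Percolation.sym2Equiv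
(Literature.Probability.LatticeModels.Site.shift v)) ⁻¹' S) = μ S) → (∀ S : Set
(Literature.Probability.Percolation.BondConfig (Literature.Probability.LatticeModels.Site 3)),
MeasurableSet S → (∀ v : Literature.Probability.LatticeModels.Site 3,
Literature.Probability.Percolation.BondConfig.relabel (Literature.Probability.Percolation.sym2Equiv
(Literature.Probability.LatticeModels.Site.shift v)) ⁻¹' S = S) → μ S = 0 ∨ μ S = 1) → (∀ N : ℕ, ∃ c
: ℝ, 0 < c ∧ ∀ S : Set (Literature.Probability.Percolation.BondConfig
(Literature.Probability.LatticeModels.Site 3)), MeasurableSet S → c * μ.real ((fun ω :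
Literature.Probability.Percolation.BondConfig (Literature.Probability.LatticeModels.Site 3) => ω ∪
↑(Literature.Probability.LatticeModels.edgesIn (Literature.Probability.LatticeModels.zdGraph 3)
(Literature.Probability.LatticeModels.box 3 N))) ⁻¹' S) ≤ μ.real S) → (∀ N : ℕ, ∃ c : ℝ, 0 < c ∧ ∀ S
: Set (Literature.Probability.Percolation.BondConfig (Literature.Probability.LatticeModels.Site 3)),
MeasurableSet S → c * μ.real ((fun ω : Literature.Probability.Percolation.BondConfig
(Literature.Probability.LatticeModels.Site 3) => ω \ ↑(Literature.Probability.LatticeModels.edgesIn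
(Literature.Probability.LatticeModels.zdGraph 3) (Literature.Probability.LatticeModels.box 3 N)))
⁻¹' S) ≤ μ.real S) → (∀ v : Literature.Probability.LatticeModels.Site 3, v ≠ 0 → Ergodic
(Literature.Probability.Percolation.BondConfig.relabel (Literature.Probability.Percolation.sym2Equiv
(Literature.Probability.LatticeModels.Site.shift v))) μ) → (∀ (γ :
Literature.Probability.LatticeModels.zdGraph 3 ≃g Literature.Probability.LatticeModels.zdGraph 3) (A
: Set (Literature.Probability.Percolation.BondConfig (Literature.Probability.LatticeModels.Site
3))), MeasurableSet A → μ (Literature.Probability.Percolation.BondConfig.relabel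
(Literature.Probability.Percolation.sym2Equiv γ.toEquiv) ⁻¹' A) = μ A) → (∀ A B : Set
(Literature.Probability.Percolation.BondConfig (Literature.Probability.LatticeModels.Site 3)),
IsUpperSet A → IsUpperSet B → MeasurableSet A → MeasurableSet B → μ A * μ B ≤ μ (A ∩ B)) → (∀ᵐ ω ∂μ,
∀ (i : Fin 3) (a : ℤ) (v : Literature.Probability.LatticeModels.Site 3), {y :
Literature.Probability.LatticeModels.Site 3 | ω ∈ Literature.Probability.Percolation.openConnIn {x :
Literature.Probability.LatticeModels.Site 3 | a ≤ x i} v y}.Finite ∧ {y :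
Literature.Probability.LatticeModels.Site 3 | ω ∈ Literature.Probability.Percolation.openConnIn {x :
Literature.Probability.LatticeModels.Site 3 | x i ≤ a} v y}.Finite) → (∃ S : Set (Sym2
(Literature.Probability.LatticeModels.Site 3)), S ⊆ {e | ∃ x :
Literature.Probability.LatticeModels.Site 3, (∀ i, (2 : ℤ) ∣ x i) ∧ e = s(x, x + Pi.single (2 : Fin
3) 1)} ∧ Filter.Tendsto (fun n : ℕ => ((S ∩ ↑(Literature.Probability.LatticeModels.edgesIn
(Literature.Probability.LatticeModels.zdGraph 3) (Literature.Probability.LatticeModels.box 3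
n))).ncard : ℝ) / ((Literature.Probability.LatticeModels.edgesIn
(Literature.Probability.LatticeModels.zdGraph 3) (Literature.Probability.LatticeModels.box 3
n)).card : ℝ)) Filter.atTop (nhds 0) ∧ ∀ᵐ ω ∂μ, ∀ x : Literature.Probability.LatticeModels.Site 3,
(Literature.Probability.Percolation.openCluster (ω \ S) x).Finite) → μ
(Literature.Probability.Percolation.percolatesAt (0 : Literature.Probability.LatticeModels.Site 3))
= 0`

## Assembly
The deciding theorem is PROVED (glue.lean = the `theorem closes` of Sketch3.lean, rc 0, no sorry):
destructure the two portrait items into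
the nine clauses of PercPotemkinWeaver's class; apply DustDeathOfStrictDiminishment to
PlugSieveStrictDiminishment to get the dust S with its three clauses; instantiate
DustRigidity at μ = bondPercolation (zdGraph 3) (criticalProbI 3) (IsProbabilityMeasure by instance)
with the nine clauses and ⟨S, …⟩ to
get μ (percolatesAt 0) = 0; `_root_.PercolationContinuityZ3` unfolds (abbrev/def) to theta (zdGraph
3) 0 (criticalProbI 3) = 0, i.e.
(μ (percolatesAt 0)).toReal = 0 — `simp only [theta, Measure.real, h0, ENNReal.toReal_zero]`.
QuantitativeSieveGain and DustGraphZ3 are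
side items (not hypotheses of `closes`).

Rationale: WHY THIS LINE. Card dust-sandwich-continuity proves (modulo AG) that ℤ³ minus a density-zero dust S
of isolated edges keeps p_c and dies at p_c, and
pairs it with the CCD supergraph into the sandwich ℤ³∖S ⊆ ℤ³ ⊆ G⁺ (all critical at the same p,
bottom continuous, top discontinuous):
no graph-general argument decides θ_{ℤ³}(p_c); what separates ℤ³ from both perturbations is exact
STATIONARITY at the finite places where
the dust lives. This route types that moral as a positive thesis in the only format that decides the
conjunct (D-0027): a RIGIDITY
statement for stationary positively-associated finite-energy measures (the Potemkin dichotomy of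
route PercPotemkinWeaver,
HaggstromMester2009 / BenjaminiLyonsPeresSchramm-style invariant-percolation axiomatics,
LyonsPeres2016 Ch. 7–8) with the card's
theorem as the DISCHARGE of a new compliance hypothesis: Bernoulli(p_c) is dust-fragile because at
p_c(ℤ³) < p_c(ℤ³ ∖ D_k)
(AizenmanGrimmett1991; GrimmettPercolation1999 §3.3 Thm (3.16) p.65 and Ex. B p.66 "lattices and
sublattices", asserted there without
proof; repair BalisterBollobasRiordan2014 = arXiv:1402.0834) the sieved lattice has finite
susceptibility (DuminilCopinTassionCMP2016,
AntunovicVeselic2007; PROVED: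
Literature.Probability.Percolation.DCTQ.summable_real_openConn_of_lt_criticalProb), so an open
crossing of a
shell of width L avoiding D_k has probability ≤ C R_k² t_k(L), t_k → 0, and widths chosen after
radii make the shells summable
(Borel–Cantelli; inside shell k, S = D_k) — the shell-tuning move of ChayesChayesDurrett1987 run on
the GRAPH at fixed p_c(ℤ³), on the
subcritical side where no renormalisation is needed. Why the dust test is not redundant with
half-space finiteness: a density-zero
MATCHING can contain whole planar cut-sets (all vertical edges between two layers), and then death
off S follows from slab finiteness;
restricting S ⊆ D₁ (all coordinates of the lower endpoint even: a quarter of the vertical edges of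
any layer at most) excludes every
cut-set, so dust-death is a genuinely new, independence-flavoured constraint (strict p_c-shift =
positive density of pivotal
configurations) that association-built weavers fail generically. Imported areas: invariant
percolation / mass-transport axiomatics
(ergodic theory), strict critical-point inequalities, sharpness, inhomogeneous (CCD) percolation.
What it does that prior routes and the
negatives index (1 SAW item, untouched) do not: PercPotemkinWeaver asks rigidity from half-space
finiteness alone; PercThresholdOne from
fragility under RANDOM thinning (law P_{q p_c}); this route adds fragility under a DETERMINISTIC
density-zero deletion — the first use of
Aizenman–Grimmett strictness inside a deciding route of this sub-problem — and files the card's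
lower-bracket theorem (DustGraphZ3) and the
linear-response question (QuantitativeSieveGain) as items. Correction to the card kept from the
retired route: larger radii thin the dust
more SLOWLY; the construction gives density → 0 at an ineffective rate, not any prescribed profile
(the card's R^{1.86} is the fastest
admissible thinning).

RANKED CRUXES. #2 DustRigidity (crux) — X of the thesis (FKG dust rigidity): for every probability
measure μ on bond configurations of ℤ³ with the nine hypotheses of FKGHalfSpaceRigidity (lattice
support, shift invariance, ℤ³-ergodicity, insertion tolerance, deletion tolerance, ergodicity under
every non-zero shift, automorphism invariance, positive association, a.s. finiteness of all
coordinate half-space clusters) and the dust clause (∃ S ⊆ D₁ of edge-density → 0 with μ-a.s. all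
clusters of ω ∖ S finite), μ(|C(0)| = ∞) = 0. FKGHalfSpaceRigidity → DustRigidity (one line,
Sketch2.lean); ¬DustRigidity is a dust-fragile FKG Potemkin weaver. [difficulty: open-problem] (why
it might fail: ¬X = an FKG weaver whose giant is a.s. cut by one fixed density-zero sub-matching of
D₁: thin 'snake' clusters threading every residue class of vertical edges mod 2^k per stretch of
length L_k would do; weavers are expected to exist (PercPotemkinWeaver r2/r4) and association is the
only obstruction.) [HaggstromMester2009, LyonsPeres2016, BenjaminiLyonsPeresSchramm1999b,
BarskyGrimmettNewman1991, GrimmettPercolation1999, BurtonKeane1989]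
#3 PlugSieveStrictDiminishment (crux) — Aizenman–Grimmett strictness for the plug sieves (card input
(AG); re-wants stmt-CriticalPhenomena-7140 of the retired PercDustSandwich; shared in substance with
cards needle-threading-strict-diminishment-v2 N1 and periodic-sieve-plug-chain S1): for every k ≥ 1,
deleting from ℤ³ the 2^kℤ³-periodic family D_k of vertical edges {x, x+e₃}, x ∈ 2^kℤ³ — an essential
periodic diminishment: a bent down-ray x → x−e₁ → x−e₁−ℕe₃ and a bent up-ray x+e₃ → x+e₃+e₁ →
x+e₃+e₁+ℕe₃, both inside ℤ³ ∖ D_k, are joined into a doubly-infinite path only through the deleted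
edge — raises the critical point STRICTLY: p_c(ℤ³, 0) < p_c(ℤ³ ∖ D_k, 0). The one unproved
literature input of the discharge, filed as its own crux. [difficulty: L] (why it might fail: No
printed proof covers this family: Grimmett 1999 §3.3 Ex. B asserts the sublattice case 'may be
adapted in a straightforward manner' without proof, AG 1991 treats stochastic enhancements of Z^d,
and BBR (arXiv:1402.0834) found gaps in AG-type essentialness arguments; no k-uniformity is
claimed.) [AizenmanGrimmett1991, GrimmettPercolation1999, BalisterBollobasRiordan2014,
arXiv:1402.0834, doi:10.1007/978-1-4899-2730-9_10]
#4 DustDeathOfStrictDiminishment (crux) — the DUST THEOREM in the event form used by `closes` (card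
S1+S2; provable now from in-tree facts): IF p_c(ℤ³) < p_c(ℤ³ ∖ D_k) for every k ≥ 1, THEN there is S
⊆ D₁ of edge-density → 0 such that P_{p_c(ℤ³)}-a.s. every cluster of ω ∖ S is finite. Proof: S :=
⋃_k (D_k ∩ shell_k), shell_k = {R_k ≤ ‖x‖_∞ < R_{k+1}}, R_{k+1} = R_k + L_k with L_k chosen AFTER
R_k so that C R_k² t_k(L_k) ≤ 2^{−k}, where t_k(L) := max over the finitely many 2^kℤ³-orbit types x
of Σ_{‖y−x‖ ≥ L} τ^{ℤ³∖D_k}_{p_c(ℤ³)}(x, y) → 0 (finite susceptibility = PROVED quasi-transitive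
sharpness strictly below p_c(ℤ³ ∖ D_k)); an open crossing of shell k by ω ∖ S is an open path of ℤ³
∖ D_k of extent ≥ L_k − 2 from one of ≤ C R_k² sites (product-measure marginals agree on shell
edges); Borel–Cantelli: a.s. finitely many shells are crossed, so all clusters of ω ∖ S are finite;
density in Λ_n for n in shell k is ≤ C 8^{−k} → 0. [deps: PlugSieveStrictDiminishment] [difficulty:
L] (why it might fail: Statement risk ~nil (paper proof audited by the card's novelty refuter);
formal risk: in-tree quasi-transitive sharpness gives finite susceptibility only, so widths are
chosen after radii from series tails; the shell/marginal bookkeeping (events of ω ∖ S determined by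
shell edges) is ~1k Lean lines.) [GrimmettPercolation1999, DuminilCopinTassionCMP2016,
AntunovicVeselic2007, ChayesChayesDurrett1987, AizenmanGrimmett1991, BarskyGrimmettNewman1991]
#5 QuantitativeSieveGain (crux) — quantitative Aizenman–Grimmett gain, LINEAR in the sieve density
(card crux EffectiveDust input (a) = needle-threading-strict-diminishment-v2 Q1; re-wants
stmt-CriticalPhenomena-7142): there is c > 0 with p_c(ℤ³ ∖ D_k, 0) ≥ p_c(ℤ³, 0) + c·8^{−k} for all k
≥ 1 (the sieve removes a fraction 8^{−k}/3 of the edges; Bernoulli dilution at density ρ shifts p_c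
by exactly p_c·ρ/(1−ρ), so the conjectural truth is δ_k ∼ p_c 8^{−k}/3: periodic and Bernoulli
dilution agree to first order at criticality). Not a hypothesis of `closes`; keys the EFFECTIVE dust
(explicit radii) together with a DKT-type correlation-length bound (Two-layer plan). [deps:
PlugSieveStrictDiminishment] [difficulty: open-problem] (why it might fail: Naive AG surgery moves
pivotality from a bulk edge to its cell's sieve edge at cost exp(O(2^k)): only δ_k ≥ 8^-k·e^{-C2^k};
linear response needs sieve and bulk edges comparably pivotal along the whole critical curve
q∈[0,p_c] — pivotal correlations at distance 2^k at criticality, unknown in d=3.)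
[AizenmanGrimmett1991, BalisterBollobasRiordan2014, GrimmettPercolation1999,
DuminilcopinKozmaTassion2020]
#9 BernoulliStationaryPortrait (support) — Bernoulli(p_c) soft portrait, part 1/2 (clauses 1,2,3,6,7
of PercPotemkinWeaver's BernoulliSoftPortrait stmt-CriticalPhenomena-4883, verbatim; split in two
only because a single item may not exceed 4000 chars — Sketch3.lean proves part1 ∧ part2 ↔
BernoulliSoftPortrait): P_{p_c} on ℤ³ is supported on lattice configurations, translation-invariant,
ℤ³-ergodic (invariant events trivial), ergodic under every single non-zero shift
(ergodic_relabel_shift_bondPercolation), and invariant under every graph automorphism of ℤ³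
(BondPercolationSymmetry). Provable now; one proof serves both routes. [difficulty: provable-now]
[GrimmettPercolation1999, Harris1960, BurtonKeane1989]
#9 BernoulliEnergyFKGPortrait (support) — Bernoulli(p_c) soft portrait, part 2/2 (clauses 4,5,8,9 of
BernoulliSoftPortrait, verbatim): insertion tolerance (opening the edges of any box Λ_N costs at
most a factor, p_c > 0), deletion tolerance ((1−p_c)^{|E(Λ_N)|}, p_c < 1:
Grimmett1999_criticalProb_pos_lt_one in tree), positive association (Harris–FKG, harris_fkg_holds),
and a.s. finiteness of all coordinate half-space clusters (BarskyGrimmettNewman1991_Z3_holds at the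
root of {0 ≤ x_0}; other roots by Harris + insertion of a path; other half-spaces by lattice
symmetry). Provable now. [difficulty: provable-now] [BarskyGrimmettNewman1991,
GrimmettPercolation1999, Harris1960, AizenmanDuminilCopinSidoraviciusCMP2015]
#9 DustGraphZ3 (support) — the card's lower-bracket theorem in GRAPH form, for citation by the
barrier catalogue and by cards needle-threading-strict-diminishment-v2 / periodic-sieve-plug-chain /
ccd-decorated-lattice (re-wants stmt-CriticalPhenomena-7143): a density-zero set S of pairwise
vertex-disjoint edges of ℤ³ with p_c(ℤ³ ∖ S, 0) = p_c(ℤ³, 0) and θ_{ℤ³∖S}(x; p_c(ℤ³)) = 0 for all x.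
From PlugSieveStrictDiminishment + the proof of DustDeathOfStrictDiminishment plus the slab step:
for p > p_c(ℤ³), Grimmett–Marstrand blocks (PROVED, GrimmettMarstrand1990_blocks_holds) give a thick
slab ℤ² × [z₀−m, z₀+m] percolating at p; placed strictly between two sieve planes z ∈ 2^Kℤ it
contains no dust of level ≥ K and finitely many finer dust edges, so it percolates in ℤ³ ∖ S and
p_c(ℤ³ ∖ S) ≤ p_c(ℤ³); ≥ is graph monotonicity. Not a hypothesis of `closes`. Together with the
(retired, record-kept) CCD supergraph statement CCDGraphZ3 it is the two-sided sandwich barrier of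
the card, to be vendored as Literature/Barriers/CriticalPhenomena/DustSandwich by a literature seat.
[difficulty: L] [BarskyGrimmettNewman1991, GrimmettPercolation1999, GrimmettMarstrand1990,
AizenmanGrimmett1991, ChayesChayesDurrett1987]

TWO-LAYER PLAN. Foreseen glued splits (k ≤ 3, depth 1), filed only after a crux closes or stalls:
DustDeathOfStrictDiminishment ⇐ ShellDeathOffSieve (for
each k ≥ 1 with p_c(ℤ³) < p_c(ℤ³ ∖ D_k): P_{p_c(ℤ³)}(∂Λ_R ↔ ∂Λ_{R+L} by an open path of ℤ³ ∖ D_k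
inside the annulus) ≤ C R² t_k(L),
t_k(L) → 0 — sharpness tail + union bound) → ShellMarginals (an event of ω ∖ S determined by the
edges of shell k has the same probability
under P^{ℤ³}_{p_c} as the corresponding event under P^{ℤ³∖D_k}_{p_c}) →
DustDeathOfStrictDiminishment (recursive radii, Borel–Cantelli).
DustRigidity ⇐ DustRigidityUnique (add the hypothesis 'a.s. at most one infinite cluster' — free for
the class by the in-tree Burton–Keane
theorem for insertion-tolerant ergodic measures, so the glue is a proved implication) →
TranslateSaturation (stationarity: death off S ⇒
death off S+v for every v, hence a.s. every infinite open path meets every translate of every D_k ∩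
shell_k it crosses, i.e. visits all
8^k residue classes of vertical edges per shell crossing) → DustRigidity (the bet: positive
association + finite energy + density θ* > 0 of
the unique giant are incompatible with such saturation). PlugSieveStrictDiminishment ⇐
SieveEssentialSurgery (AG differential inequality
∂θ_n/∂q ≥ c_k ∂θ_n/∂p for the two-parameter model 'sieve edges open w.p. q, bulk edges w.p. p', c_k
> 0 may depend on k) →
CriticalCurveIntegration (Grimmett (3.19)–(3.22)) → PlugSieveStrictDiminishment.
QuantitativeSieveGain ⇐ SievePivotalComparability (c_k ≥
c 8^{−k}/3 uniformly along the critical curve) → the same integration; EffectiveDust (explicit radii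
R_k = ⌈exp(C·64^k)⌉, dust density ≍
(log R)^{−1/2}) becomes a crux only after QuantitativeSieveGain AND a DKT-type port Ξ(ℤ³ ∖ D_k at
p_c(ℤ³)) ≤ exp(C δ_k^{−2})
(DuminilcopinKozmaTassion2020) land.

KILL CRITERIA. DustRigidity refuted (an explicit dust-fragile FKG weaver) closes the route
`refuted:DustRigidity` — and refutes FKGHalfSpaceRigidity of
PercPotemkinWeaver at the same time (X is weaker), completing the Potemkin barrier up to association
+ dust: positive routes must then use
independence quantitatively beyond strict p_c-shifts; DustGraphZ3 / DustDeath stay true and are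
handed to the barrier catalogue.
PlugSieveStrictDiminishment refuted for some k ≥ 1 (a periodic essential single-edge diminishment
NOT raising p_c) kills the discharge:
close `refuted:PlugSieveStrictDiminishment` (and record the sensation against
GrimmettPercolation1999 §3.3 Ex. B).
DustDeathOfStrictDiminishment cannot fail unless mis-typed: a counterexample to the TYPED clauses
forces `--restate`, not a close.
QuantitativeSieveGain refuted (sub-linear response) ⇒ `--drop` (not load-bearing; record the rate
for needle-threading-v2). FKGHalfSpaceRigidity
PROVED elsewhere proves X outright (the route then closes positively through PercPotemkinWeaver's
theorem + this glue); θ(p_c) = 0 proved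
elsewhere moots the staffing but refutes nothing. A printed density-zero same-p_c diminishment of
ℤ^d dying at p_c makes DustGraphZ3 `known`.

NOT DECOMPOSED YET. The AG differential inequality and its critical-curve integration (children of
crux 3); shell estimate, marginal transfer and the
recursive-radii bookkeeping (children of crux 4); the uniqueness/translate-saturation reductions of
X (children of crux 2, see Two-layer
plan) — in particular NO attempt is made at open to split X by the structure of μ (monotone factors
of i.i.d. labels as in
PercMonotoneFactors / PercThresholdOne would be the natural first rung: 'no antitone equivariant
finite-range factor of i.i.d. labels is a
dust-fragile weaving giant'); the DKT port and EffectiveDust (conditional on crux 5); the barrier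
FILE
Literature/Barriers/CriticalPhenomena/DustSandwich.lean (card S3: shared-invariant checklist of
ℤ³∖S, ℤ³, G⁺) — vendored by a literature
seat from DustGraphZ3 and the record file Theses/PercCCDGraph.lean, not by planners; the card's S4
'PercolationContinuityZ3 ↔ θ_{ℤ³}(p_c) =
θ_{ℤ³∖S}(p_c)' is deliberately NOT an item (wrong-sided restatement, z3-extremal-comparison-barrier
M1); helper lemmas (D₁ is a matching
of lattice edges — proved in the planner's Glue.lean sketch; p_c root-independence; θ-monotonicity
under deleteEdges) ride with
--supports, never items.

CHEAPEST FALSIFIER. (1) For X: is a dust-fragile stationary FKG finite-energy percolating measure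
already on file or in print? Check the weaver designs
(cards fkg-weaver-monotone-dag, ust-hull-potemkin, potemkin-weaver; HaggstromMester2009 §§3–4): a
design whose scale-k connections are single
vertical edges threading ALL residue classes mod 2^k is the candidate; if one is certified FKG, X
dies cheaply (and FKGHalfSpaceRigidity with
it). (2) For crux 3, a 15-minute lookup: is the sublattice strict inequality PROVED beyond
Grimmett's Ex. B remark (p.66) — Kesten 1982
Ch. 10 (doi:10.1007/978-1-4899-2730-9_10), Menshikov 1987, Grimmett–Stacey 1998,
BalisterBollobasRiordan2014 §1–2? If yes, crux 3 becomes
a cite fact (route cheaper, not killed). Ran here: Grimmett1999 pp.64–66 read (Thm (3.16) =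
stochastic enhancements of ℤ^d, s > 0;
diminishments/sublattices are unproved remarks); crossref (10 rows: AizenmanGrimmett1991, Kesten
1982 Ch. 10, nothing settling Ex. B);
remote searchd unavailable (rc 75, twice). (3) Monte Carlo, 10 min of kit (left to the refuter):
p_c(ℤ³ ∖ D_k) − 0.2488 for
k = 1, 2, 3 on 64³–128³ tori; ratios ≈ 1/8 per level support crux 5.

NUMBERS. p_c(ℤ³, bond) ≈ 0.2488126 (numerical, Wang–Zhou–Zhang–Garoni–Deng 2013; no rigorous value
needed). Sieve D_k: one deleted edge per 8^k
sites = a fraction ρ_k = 8^{−k}/3 of the edges; D₁ meets any horizontal layer in ≤ 1/4 of its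
vertical edges (never a cut-set); degrees
in ℤ³ ∖ S ∈ {5, 6}; |Λ_n| = (2n+1)³, |E(Λ_n)| = 3(2n+1)²·2n. Bernoulli dilution at density ρ: p_c(ρ)
= p_c/(1−ρ) (benchmark for crux 5).
Dust density inside Λ_n for n in shell k: ≤ C·8^{−k}, → 0 at the INEFFECTIVE rate forced by R_{k+1}
− R_k ≥ L_k; heuristic fastest
thinning (card; ν ≈ 0.88): ≍ R^{3−1/ν} ≈ R^{1.86} dust edges within radius R; effective version
(conditional on crux 5 + DKT port):
R_k = exp(C·64^k), density ≍ (log R)^{−1/2}. Items at open: 8 (4 cruxes, 3 support, assembly);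
`closes` uses 5 of them.

DEFINITION REQUESTS. None. Sieves D_k = {s(x, x+e₃) : 2^k ∣ x_i ∀ i}, the dust S, shells and the
measure class are inline; `SimpleGraph.deleteEdges` (Mathlib)
renders ℤ³ ∖ S; criticalProb / theta / criticalProbI / percolatesAt / openCluster / openConnIn /
edgesIn / box / BondConfig.relabel /
sym2Equiv / Site.shift are existing declarations (Sketch3.lean rc 0 with import
Literature.Probability.Percolation.UniquenessInsertionTolerant,
the import of PercPotemkinWeaver). No cite-fact item is filed for AG: the unproved fact is crux 3
itself.

Novelty: Searches (2026-08-15): `lit search --hybrid "strict inequality critical probability diminishment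
periodic sublattice essential enhancement"`
(10 docs; Grimmett1999 pp.64–66,71 and BollobasRiordan2006 p.22 relevant; read Grimmett (3.16) p.65,
Ex. B/C/E p.66); `lit search --source
crossref` ×2 ("strict inequalities critical points percolation enhancement sublattice":
AizenmanGrimmett1991, Kesten 1982 Ch. 10
doi:10.1007/978-1-4899-2730-9_10, Franceschetti–Penrose–Rosoman 2011; "percolation dilute lattice
defects density zero critical probability
unchanged": nothing relevant); `lit galaxy search … --star all` ×4 (0 relevant rows); `lit frontier
CriticalPhenomena --since 2020` (30
descendants: planar/high-d/SLE, none on diminished ℤ³ or dust-robustness of FKG measures);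
OpenAlex/S2/arXiv/zbMATH searchd unavailable
(rc 75, twice); tree: `lean search AizenmanGrimmett|diminish|enhancement` (no AG named fact), all
Theses of the sub (PercPotemkinWeaver =
the rigidity template, PercThresholdOne = random-thinning fragility, PercMonotoneFactors;
PercDustSandwich/PercCCDGraph retired records),
the card's audit trail, `ledger negatives` (1 SAW item).
Nearest prior art found: GrimmettPercolation1999 Thm (7.35) = BarskyGrimmettNewman1991 (half-spaces:
the known same-p_c subgraphs dying at
p_c, by steering); GrimmettPercolation1999 §3.3 Thm (3.16) + Ex. B and AizenmanGrimmett1991 /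
BalisterBollobasRiordan2014 = arXiv:1402.0834
(strict shifts for essential enhancements; sublattice case a remark  [refs: 10.1007/978-1-4899-2730-9_10, 1402.0834, doi:10.1007/978-1-4899-2730-9_10, Grimmett1999, BollobasRiordan2006, AizenmanGrimmett1991, GrimmettPercolation1999, BarskyGrimmettNewman1991, BalisterBollobasRiordan2014, HaggstromMester2009, LyonsPeres2016]

Barriers (technique_class: AG-strictness dust Borel-Cantelli FKG-rigidity dichotomy): - technique_class: AG-strictness dust Borel-Cantelli FKG-rigidity dichotomy
- Literature.Barriers.CriticalPhenomena.AmenableInvariantPercolation: met head-on and evaded by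
hypothesis, exactly as PercPotemkinWeaver: that entry voids SIZE-BLIND degree/density thresholds for
invariant percolation on amenable ℤ³; X asks for no threshold — its hypotheses are association,
finite energy, half-space finiteness and dust-death, none of which the BLPS counterexamples (which
are not insertion-tolerant, not FKG-with-density) satisfy jointly; conceded: if an FKG dust-fragile
weaver exists, X is false and the entry's moral extends to association.
- Literature.Barriers.CriticalPhenomena.TreesPercolatingAtCriticality: not met — X quantifies over
measures on the TRANSITIVE lattice ℤ³ and uses stationarity essentially; the side item DustGraphZ3
(with the retired CCD record) SHARPENS the entry into a two-sided same-p_c sandwich, consistent with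
CriticalTreesExponentialGrowth.
- Literature.Barriers.CriticalPhenomena.SubexponentialGrowthZd: not met — no
growth/susceptibility-decay method is applied to ℤ³ itself; susceptibility enters only on the
strictly subcritical sieved lattices ℤ³ ∖ D_k at p_c(ℤ³) < p_c(ℤ³ ∖ D_k), where it is a theorem.
- Literature.Barriers.CriticalPhenomena.SprinklingRenormalisation: not met in `closes` (no
renormalisation anywhere in the discharge: subcritical sharpness does the work shell by shell); used
legitimately only in the side item DustGraphZ3, above p_c(ℤ³) (GM sla

History (route lifecycle, newest last):
- 2026-08-15T17:50:59Z · rev 2: restated DustGraphZ3 (stmt-CriticalPhenomena-9597) — precision repair of SUPPORT item DustGraphZ3 (stmt-9597) per route-review refuters g2/g3: S = emptyset and the planar cut (all vertical edges between two layers (planner-rrepair-CriticalPhenomena-PercDustRigi-09620bff-g4-0)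
- 2026-08-22T12:04:49Z · DORMANT — reconciler: no traction for 5.3 d (last activity statement-grounded at 2026-08-17T03:51:42Z); parked, not closed — `ledger route dormant route-CriticalPhenomena (operator:999:225259)
- 2026-08-23T14:52:07Z · REACTIVATED — reconciler: reactivated — activity item-proof-filed at 2026-08-23T12:26:01Z after parking at 2026-08-22T12:04:49Z (operator:999:1768532)

sub-problem: PercolationContinuityZ3 · status: open · opened planner-plancard-CriticalPhenomena-Percolatio-e80b40be-0 2026-08-15T14:03:09Z · rev 3 · ledger route-CriticalPhenomena-PercDustRigidity
GENERATED by the gate from the ledger (D-0016/17). Provers cite these decls: `theorem foo : Summit.CriticalPhenomena.PercolationContinuityZ3.Theses.PercDustRigidity.<Decl> := …` in Summits/CriticalPhenomena/PercolationContinuityZ3/Theorems/<Name>.lean.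
-/

namespace Summit.CriticalPhenomena.PercolationContinuityZ3.Theses.PercDustRigidity

open scoped BigOperators Topology Manifold Classical MeasureTheory ProbabilityTheory Matrix InnerProductSpace ComplexConjugate ContinuousMap
open Filter Set Function TopologicalSpace MeasureTheory

attribute [summit_statement] _root_.PercolationContinuityZ3

/-- item stmt-CriticalPhenomena-9591 · crux · rank 2 · open · by planner
why it might fail: ¬X = a dust-fragile FKG Potemkin weaver: stationary, associated, finite-energy μ with finite half-space clusters whose giant is cut by one density-zero sub-matching of D₁; weavers are expected (HaggstromMester2009 genre); refuter F1: supercritical P_p, p<p_c(Z³∖D₁), meets every hypothesis but (10).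
sources: HaggstromMester2009, LyonsPeres2016, BenjaminiLyonsPeresSchramm1999b, BarskyGrimmettNewman1991, GrimmettPercolation1999, BurtonKeane1989
[crux] X of the thesis (FKG dust rigidity): for every probability measure μ on bond configurations
of ℤ³ with the nine hypotheses of FKGHalfSpaceRigidity (lattice support, shift invariance,
ℤ³-ergodicity, insertion tolerance, deletion tolerance, ergodicity under every non-zero shift,
automorphism invariance, positive association, a.s. finiteness of all coordinate half-space
clusters) and the dust clause (∃ S ⊆ D₁ of edge-density → 0 with μ-a.s. all clusters of ω ∖ S
finite), μ(|C(0)| = ∞) = 0. FKGHalfSpaceRigidity → DustRigidity (one line, Sketch2.lean);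
¬DustRigidity is a dust-fragile FKG Potemkin weaver. [difficulty: open-problem] -/
@[route_item "route-CriticalPhenomena-PercDustRigidity"]
def DustRigidity : Prop :=
  ∀ μ : MeasureTheory.Measure (Literature.Probability.Percolation.BondConfig (Literature.Probability.LatticeModels.Site 3)), MeasureTheory.IsProbabilityMeasure μ → (∀ᵐ ω ∂μ, ω ⊆ (Literature.Probability.LatticeModels.zdGraph 3).edgeSet) → (∀ (v : Literature.Probability.LatticeModels.Site 3) (S : Set (Literature.Probability.Percolation.BondConfig (Literature.Probability.LatticeModels.Site 3))), MeasurableSet S → μ (Literature.Probability.Percolation.BondConfig.relabel (Literature.Probability.Percolation.sym2Equiv (Literature.Probability.LatticeModels.Site.shift v)) ⁻¹' S) = μ S) → (∀ S : Set (Literature.Probability.Percolation.BondConfig (Literature.Probability.LatticeModels.Site 3)), MeasurableSet S → (∀ v : Literature.Probability.LatticeModels.Site 3, Literature.Probability.Percolation.BondConfig.relabel (Literature.Probability.Percolation.sym2Equiv (Literature.Probability.LatticeModels.Site.shift v)) ⁻¹' S = S) → μ S = 0 ∨ μ S = 1) → (∀ N : ℕ, ∃ c : ℝ, 0 < c ∧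 ∀ S : Set (Literature.Probability.Percolation.BondConfig (Literature.Probability.LatticeModels.Site 3)), MeasurableSet S → c * μ.real ((fun ω : Literature.Probability.Percolation.BondConfig (Literature.Probability.LatticeModels.Site 3) => ω ∪ ↑(Literature.Probability.LatticeModels.edgesIn (Literature.Probability.LatticeModels.zdGraph 3) (Literature.Probability.LatticeModels.box 3 N))) ⁻¹' S) ≤ μ.real S) → (∀ N : ℕ, ∃ c : ℝ, 0 < c ∧ ∀ S : Set (Literature.Probability.Percolation.BondConfig (Literature.Probability.LatticeModels.Site 3)), MeasurableSet S → c * μ.real ((fun ω : Literature.Probability.Percolation.BondConfig (Literature.Probability.LatticeModels.Site 3) => ω \ ↑(Literature.Probability.LatticeModels.edgesIn (Literature.Probability.LatticeModels.zdGraph 3) (Literature.Probability.LatticeModels.box 3 N))) ⁻¹' S) ≤ μ.real S) → (∀ v : Literature.Probability.LatticeModels.Site 3, v ≠ 0 → Ergodic (Literature.Probability.Percolation.BondConfig.relabel (Literature.Probability.Percolation.sym2Equiv (Literature.Probability.LatticeModels.Site.shift v))) μ) → (∀ (γ : Literature.Probability.LatticeModels.zdGraph 3 ≃g Literature.Probability.LatticeModels.zdGraph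 3) (A : Set (Literature.Probability.Percolation.BondConfig (Literature.Probability.LatticeModels.Site 3))), MeasurableSet A → μ (Literature.Probability.Percolation.BondConfig.relabel (Literature.Probability.Percolation.sym2Equiv γ.toEquiv) ⁻¹' A) = μ A) → (∀ A B : Set (Literature.Probability.Percolation.BondConfig (Literature.Probability.LatticeModels.Site 3)), IsUpperSet A → IsUpperSet B → MeasurableSet A → MeasurableSet B → μ A * μ B ≤ μ (A ∩ B)) → (∀ᵐ ω ∂μ, ∀ (i : Fin 3) (a : ℤ) (v : Literature.Probability.LatticeModels.Site 3), {y : Literature.Probability.LatticeModels.Site 3 | ω ∈ Literature.Probability.Percolation.openConnIn {x : Literature.Probability.LatticeModels.Site 3 | a ≤ x i} v y}.Finite ∧ {y : Literature.Probability.LatticeModels.Site 3 | ω ∈ Literature.Probability.Percolation.openConnIn {x : Literature.Probability.LatticeModels.Site 3 | x i ≤ a} v y}.Finite) → (∃ S : Set (Sym2 (Literature.Probability.LatticeModels.Site 3)), S ⊆ {e | ∃ x : Literature.Probability.LatticeModels.Site 3, (∀ i, (2 : ℤ) ∣ x i) ∧ e = s(x, x + Pi.single (2 : Fin 3) 1)}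 ∧ Filter.Tendsto (fun n : ℕ => ((S ∩ ↑(Literature.Probability.LatticeModels.edgesIn (Literature.Probability.LatticeModels.zdGraph 3) (Literature.Probability.LatticeModels.box 3 n))).ncard : ℝ) / ((Literature.Probability.LatticeModels.edgesIn (Literature.Probability.LatticeModels.zdGraph 3) (Literature.Probability.LatticeModels.box 3 n)).card : ℝ)) Filter.atTop (nhds 0) ∧ ∀ᵐ ω ∂μ, ∀ x : Literature.Probability.LatticeModels.Site 3, (Literature.Probability.Percolation.openCluster (ω \ S) x).Finite) → μ (Literature.Probability.Percolation.percolatesAt (0 : Literature.Probability.LatticeModels.Site 3)) = 0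

/-- item stmt-CriticalPhenomena-18885 · aside · rank 2 · open · by planner
why it might fail: An FKG, automorphism-invariant needle weaver killed by every dyadic sieve (fat finite blobs joined through single vertical edges at all levels; cf. PercSieveRigidity.NeedleWeaverExists, card fkg-weaver-monotone-dag) refutes it; association is the only known obstruction.
sources: HaggstromMester2009, BenjaminiTassion2017, LyonsPeres2016, BurtonKeane1989, AizenmanGrimmett1991, GrimmettPercolation1999
[crux] (strategist split of DustRigidity, piece X1 — NO INFINITELY FRAGILE GIANT) for every
probability measure μ on bond configurations of ℤ³ with the nine hypotheses (H1)–(H9) of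
DustRigidity (lattice support, shift invariance, ergodicity, insertion and deletion tolerance,
ergodicity under every non-zero shift, automorphism invariance, positive association, a.s. finite
coordinate half-space clusters), a.s. at most one infinite cluster (free for the class:
Burton–Keane, in tree), and such that for EVERY level k ≥ 1 the plug sieve D_k = {s(y, y+e₃) : 2^k ∣
y_i ∀ i} kills all infinite clusters (μ-a.s. every cluster of ω∖D_k is finite), μ(|C(0)| = ∞) = 0.
The waypoint '∀ k, Death(D_k)' is exactly what PlugSieveStrictDiminishment gives P_{p_c} at every
level (Bernoulli(p_c(ℤ³)) on ℤ³∖D_k is subcritical) with no shells and no Borel–Cantelli.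
DustRigidity ⟹ X1 (the shell construction of DustDeathOfStrictDiminishment turns '∀ k Death(D_k)'
into a density-zero killing dust ⊆ D₁) and X1 ⟹ PercSieveRigidity.FKGSieveRigidity
(stmt-CriticalPhenomena-11218, which assumes in addition all periods/directions and the exit law):
X1 is the rung strictly between the two routes' theses. Within Bernoul -/
@[route_item "route-CriticalPhenomena-PercDustRigidity"]
def NoInfinitelyFragileGiant : Prop :=
  ∀ μ : MeasureTheory.Measure (Literature.Probability.Percolation.BondConfig (Literature.Probability.LatticeModels.Site 3)), MeasureTheory.IsProbabilityMeasure μ → (∀ᵐ ω ∂μ, ω ⊆ (Literature.Probability.LatticeModels.zdGraph 3).edgeSet) → (∀ (v : Literature.Probability.LatticeModels.Site 3) (S : Set (Literature.Probability.Percolation.BondConfig (Literature.Probability.LatticeModels.Site 3))), MeasurableSet S → μ (Literature.Probability.Percolation.BondConfig.relabel (Literature.Probability.Percolation.sym2Equiv (Literature.Probability.LatticeModels.Site.shift v)) ⁻¹' S) = μ S) → (∀ S : Set (Literature.Probability.Percolation.BondConfig (Literature.Probability.LatticeModels.Site 3)), MeasurableSet S → (∀ v : Literature.Probability.LatticeModels.Site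 3, Literature.Probability.Percolation.BondConfig.relabel (Literature.Probability.Percolation.sym2Equiv (Literature.Probability.LatticeModels.Site.shift v)) ⁻¹' S = S) → μ S = 0 ∨ μ S = 1) → (∀ N : ℕ, ∃ c : ℝ, 0 < c ∧ ∀ S : Set (Literature.Probability.Percolation.BondConfig (Literature.Probability.LatticeModels.Site 3)), MeasurableSet S → c * μ.real ((fun ω : Literature.Probability.Percolation.BondConfig (Literature.Probability.LatticeModels.Site 3) => ω ∪ ↑(Literature.Probability.LatticeModels.edgesIn (Literature.Probability.LatticeModels.zdGraph 3) (Literature.Probability.LatticeModels.box 3 N))) ⁻¹' S) ≤ μ.real S) → (∀ N : ℕ, ∃ c : ℝ, 0 < c ∧ ∀ S : Set (Literature.Probability.Percolation.BondConfig (Literature.Probability.LatticeModels.Site 3)), MeasurableSet S → c * μ.real ((fun ω : Literature.Probability.Percolation.BondConfig (Literature.Probability.LatticeModels.Site 3) => ω \ ↑(Literature.Probability.LatticeModels.edgesIn (Literature.Probability.LatticeModels.zdGraph 3) (Literature.Probability.LatticeModels.box 3 N))) ⁻¹' S) ≤ μ.real S) → (∀ v : Literature.Probability.LatticeModels.Site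 3, v ≠ 0 → Ergodic (Literature.Probability.Percolation.BondConfig.relabel (Literature.Probability.Percolation.sym2Equiv (Literature.Probability.LatticeModels.Site.shift v))) μ) → (∀ (γ : Literature.Probability.LatticeModels.zdGraph 3 ≃g Literature.Probability.LatticeModels.zdGraph 3) (A : Set (Literature.Probability.Percolation.BondConfig (Literature.Probability.LatticeModels.Site 3))), MeasurableSet A → μ (Literature.Probability.Percolation.BondConfig.relabel (Literature.Probability.Percolation.sym2Equiv γ.toEquiv) ⁻¹' A) = μ A) → (∀ A B : Set (Literature.Probability.Percolation.BondConfig (Literature.Probability.LatticeModels.Site 3)), IsUpperSet A → IsUpperSet B → MeasurableSet A → MeasurableSet B → μ A * μ B ≤ μ (A ∩ B)) → (∀ᵐ ω ∂μ, ∀ (i : Fin 3) (a : ℤ) (v : Literature.Probability.LatticeModels.Site 3), {y : Literature.Probability.LatticeModels.Site 3 | ω ∈ Literature.Probability.Percolation.openConnIn {x : Literature.Probability.LatticeModels.Site 3 | a ≤ x i} v y}.Finite ∧ {y : Literature.Probability.LatticeModels.Site 3 | ω ∈ Literature.Probability.Percolation.openConnIn {x : Literature.Probability.LatticeModels.Site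 3 | x i ≤ a} v y}.Finite) → (∀ᵐ ω ∂μ, Literature.Probability.Percolation.numInfiniteClusters ω ≤ 1) → (∀ k : ℕ, 1 ≤ k → ∀ᵐ ω ∂μ, ∀ x : Literature.Probability.LatticeModels.Site 3, (Literature.Probability.Percolation.openCluster (ω \ {e | ∃ y : Literature.Probability.LatticeModels.Site 3, (∀ i, (2 ^ k : ℤ) ∣ y i) ∧ e = s(y, y + Pi.single (2 : Fin 3) 1)}) x).Finite) → μ (Literature.Probability.Percolation.percolatesAt (0 : Literature.Probability.LatticeModels.Site 3)) = 0

/-- item stmt-CriticalPhenomena-18902 · aside · rank 3 · open · by planner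
why it might fail: A weaver whose fragility threshold sits between two dyadic levels (killed by D_k, surviving D_{k+1}) refutes it; profile-tuned FKG weavers are exactly as (im)plausible as FKG weavers (PercPotemkinWeaver ranks 2/4); no mechanism beyond (H9) + stationarity is known.
sources: AizenmanGrimmett1991, GrimmettPercolation1999, GrimmettMarstrand1990, HaggstromMester2009, LyonsPeres2016, BarskyGrimmettNewman1991
[crux] (strategist split of DustRigidity, piece X2 — SIEVE COARSENING) for every probability measure
μ with (H1)–(H9) and a.s. at most one infinite cluster, and every k ≥ 1: if μ-a.s. all clusters of
ω∖D_k are finite then μ-a.s. all clusters of ω∖D_{k+1} are finite (D_{k+1} ⊆ D_k, eight times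
sparser). D_k is the disjoint union of the eight cosets D_{k+1} + v, v ∈ {0, 2^k}³, interchangeable
under μ by (H2); X2 says: a giant cut into finite pieces by the union of eight interchangeable
cosets is already cut by one of them. (H9) is load-bearing exactly here: P_p with p_c(ℤ³∖D_{k+1}) <
p < p_c(ℤ³∖D_k) satisfies everything but (H9) (Grimmett–Marstrand slabs) and violates the
conclusion. Implied by the undecorated form of DustRigidity ('(H1)–(H9) + Death(D₁) ⇒ no
percolation'); together with X1 it gives DustRigidity by induction on the level (assembly
dustRigidity_of_subs, PROVED, Cruxes/DustRigidity/SplitAssembly.lean). Not needed by a `closes`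
re-glued through X1 (tenure note on X1) — staff after X1. Birth skeleton:
Cruxes/DustRigidity/Lines/x2_birth.lean (stub_cosetSymmetry — provable; stub_core — the heart). (why
it might fail: A weaver whose fragility threshold sits between two dyad -/
@[route_item "route-CriticalPhenomena-PercDustRigidity"]
def SieveCoarsening : Prop :=
  ∀ μ : MeasureTheory.Measure (Literature.Probability.Percolation.BondConfig (Literature.Probability.LatticeModels.Site 3)), MeasureTheory.IsProbabilityMeasure μ → (∀ᵐ ω ∂μ, ω ⊆ (Literature.Probability.LatticeModels.zdGraph 3).edgeSet) → (∀ (v : Literature.Probability.LatticeModels.Site 3) (S : Set (Literature.Probability.Percolation.BondConfig (Literature.Probability.LatticeModels.Site 3))), MeasurableSet S → μ (Literature.Probability.Percolation.BondConfig.relabel (Literature.Probability.Percolation.sym2Equiv (Literature.Probability.LatticeModels.Site.shift v)) ⁻¹' S) = μ S) → (∀ S : Set (Literature.Probability.Percolation.BondConfig (Literature.Probability.LatticeModels.Site 3)), MeasurableSet S → (∀ v : Literature.Probability.LatticeModels.Site 3, Literature.Probability.Percolation.BondConfig.relabel (Literature.Probability.Percolation.sym2Equiv (Literature.Probability.LatticeModels.Site.shift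 v)) ⁻¹' S = S) → μ S = 0 ∨ μ S = 1) → (∀ N : ℕ, ∃ c : ℝ, 0 < c ∧ ∀ S : Set (Literature.Probability.Percolation.BondConfig (Literature.Probability.LatticeModels.Site 3)), MeasurableSet S → c * μ.real ((fun ω : Literature.Probability.Percolation.BondConfig (Literature.Probability.LatticeModels.Site 3) => ω ∪ ↑(Literature.Probability.LatticeModels.edgesIn (Literature.Probability.LatticeModels.zdGraph 3) (Literature.Probability.LatticeModels.box 3 N))) ⁻¹' S) ≤ μ.real S) → (∀ N : ℕ, ∃ c : ℝ, 0 < c ∧ ∀ S : Set (Literature.Probability.Percolation.BondConfig (Literature.Probability.LatticeModels.Site 3)), MeasurableSet S → c * μ.real ((fun ω : Literature.Probability.Percolation.BondConfig (Literature.Probability.LatticeModels.Site 3) => ω \ ↑(Literature.Probability.LatticeModels.edgesIn (Literature.Probability.LatticeModels.zdGraph 3) (Literature.Probability.LatticeModels.box 3 N))) ⁻¹' S) ≤ μ.real S) → (∀ v : Literature.Probability.LatticeModels.Site 3, v ≠ 0 → Ergodic (Literature.Probability.Percolation.BondConfig.relabel (Literature.Probability.Percolation.sym2Equiv (Literature.Probability.LatticeModels.Site.shift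 v))) μ) → (∀ (γ : Literature.Probability.LatticeModels.zdGraph 3 ≃g Literature.Probability.LatticeModels.zdGraph 3) (A : Set (Literature.Probability.Percolation.BondConfig (Literature.Probability.LatticeModels.Site 3))), MeasurableSet A → μ (Literature.Probability.Percolation.BondConfig.relabel (Literature.Probability.Percolation.sym2Equiv γ.toEquiv) ⁻¹' A) = μ A) → (∀ A B : Set (Literature.Probability.Percolation.BondConfig (Literature.Probability.LatticeModels.Site 3)), IsUpperSet A → IsUpperSet B → MeasurableSet A → MeasurableSet B → μ A * μ B ≤ μ (A ∩ B)) → (∀ᵐ ω ∂μ, ∀ (i : Fin 3) (a : ℤ) (v : Literature.Probability.LatticeModels.Site 3), {y : Literature.Probability.LatticeModels.Site 3 | ω ∈ Literature.Probability.Percolation.openConnIn {x : Literature.Probability.LatticeModels.Site 3 | a ≤ x i} v y}.Finite ∧ {y : Literature.Probability.LatticeModels.Site 3 | ω ∈ Literature.Probability.Percolation.openConnIn {x : Literature.Probability.LatticeModels.Site 3 | x i ≤ a} v y}.Finite) → (∀ᵐ ω ∂μ, Literature.Probability.Percolation.numInfiniteClusters ω ≤ 1) → ∀ k : ℕ, 1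 ≤ k → (∀ᵐ ω ∂μ, ∀ x : Literature.Probability.LatticeModels.Site 3, (Literature.Probability.Percolation.openCluster (ω \ {e | ∃ y : Literature.Probability.LatticeModels.Site 3, (∀ i, (2 ^ k : ℤ) ∣ y i) ∧ e = s(y, y + Pi.single (2 : Fin 3) 1)}) x).Finite) → ∀ᵐ ω ∂μ, ∀ x : Literature.Probability.LatticeModels.Site 3, (Literature.Probability.Percolation.openCluster (ω \ {e | ∃ y : Literature.Probability.LatticeModels.Site 3, (∀ i, (2 ^ (k + 1) : ℤ) ∣ y i) ∧ e = s(y, y + Pi.single (2 : Fin 3) 1)}) x).Finite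

/-- item stmt-CriticalPhenomena-9592 · support · rank 3 · closed · proved by Summit.CriticalPhenomena.PercolationContinuityZ3.Theorems.plugSieveStrictDiminishment_main_proof @ 1cfa278dfa46 (prover) · by planner
why it might fail: No printed proof covers this family: Grimmett 1999 §3.3 Ex. B asserts the sublattice case 'may be adapted in a straightforward manner' without proof, AG 1991 treats stochastic enhancements of Z^d, and BBR (arXiv:1402.0834) found gaps in AG-type essentialness arguments; no k-uniformity is claimed.
sources: AizenmanGrimmett1991, GrimmettPercolation1999, BalisterBollobasRiordan2014, arXiv:1402.0834, Menshikov1988, Menshikov1987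
[crux] Aizenman–Grimmett strictness for the plug sieves (card input (AG); re-wants
stmt-CriticalPhenomena-7140 of the retired PercDustSandwich; shared in substance with cards
needle-threading-strict-diminishment-v2 N1 and periodic-sieve-plug-chain S1): for every k ≥ 1,
deleting from ℤ³ the 2^kℤ³-periodic family D_k of vertical edges {x, x+e₃}, x ∈ 2^kℤ³ — an essential
periodic diminishment: a bent down-ray x → x−e₁ → x−e₁−ℕe₃ and a bent up-ray x+e₃ → x+e₃+e₁ →
x+e₃+e₁+ℕe₃, both inside ℤ³ ∖ D_k, are joined into a doubly-infinite path only through the deleted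
edge — raises the critical point STRICTLY: p_c(ℤ³, 0) < p_c(ℤ³ ∖ D_k, 0). The one unproved
literature input of the discharge, filed as its own crux. [difficulty: L] -/
@[route_item "route-CriticalPhenomena-PercDustRigidity"]
def PlugSieveStrictDiminishment : Prop :=
  ∀ k : ℕ, 1 ≤ k → Literature.Probability.Percolation.criticalProb (Literature.Probability.LatticeModels.zdGraph 3) 0 < Literature.Probability.Percolation.criticalProb ((Literature.Probability.LatticeModels.zdGraph 3).deleteEdges {e | ∃ x : Literature.Probability.LatticeModels.Site 3, (∀ i, (2 ^ k : ℤ) ∣ x i) ∧ e = s(x, x + Pi.single (2 : Fin 3) 1)}) 0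

/-- item stmt-CriticalPhenomena-9593 · support · rank 4 · closed · proved by Summit.CriticalPhenomena.PercolationContinuityZ3.Theorems.DustRigidityDustDeathOfStrictDiminishment.dustDeathOfStrictDiminishment_proof @ 1a2588ee967d (prover) · by planner
why it might fail: Statement risk ~nil (paper proof audited by the card's novelty refuter); formal risk: in-tree quasi-transitive sharpness gives finite susceptibility only, so widths are chosen after radii from series tails; the shell/marginal bookkeeping (events of ω ∖ S determined by shell edges) is ~1k Lean lines.
sources: DuminilCopinTassionCMP2016, AntunovicVeselic2007, ChayesChayesDurrett1987, GrimmettPercolation1999, Literature.Probability.Percolation.DCTQ.summable_real_openConn_of_lt_criticalProb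
[crux] the DUST THEOREM in the event form used by `closes` (card S1+S2; provable now from in-tree
facts): IF p_c(ℤ³) < p_c(ℤ³ ∖ D_k) for every k ≥ 1, THEN there is S ⊆ D₁ of edge-density → 0 such
that P_{p_c(ℤ³)}-a.s. every cluster of ω ∖ S is finite. Proof: S := ⋃_k (D_k ∩ shell_k), shell_k =
{R_k ≤ ‖x‖_∞ < R_{k+1}}, R_{k+1} = R_k + L_k with L_k chosen AFTER R_k so that C R_k² t_k(L_k) ≤
2^{−k}, where t_k(L) := max over the finitely many 2^kℤ³-orbit types x of Σ_{‖y−x‖ ≥ L}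
τ^{ℤ³∖D_k}_{p_c(ℤ³)}(x, y) → 0 (finite susceptibility = PROVED quasi-transitive sharpness strictly
below p_c(ℤ³ ∖ D_k)); an open crossing of shell k by ω ∖ S is an open path of ℤ³ ∖ D_k of extent ≥
L_k − 2 from one of ≤ C R_k² sites (product-measure marginals agree on shell edges); Borel–Cantelli:
a.s. finitely many shells are crossed, so all clusters of ω ∖ S are finite; density in Λ_n for n in
shell k is ≤ C 8^{−k} → 0. [deps: PlugSieveStrictDiminishment] [difficulty: L] -/
@[route_item "route-CriticalPhenomena-PercDustRigidity"]
def DustDeathOfStrictDiminishment : Prop :=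
  (∀ k : ℕ, 1 ≤ k → Literature.Probability.Percolation.criticalProb (Literature.Probability.LatticeModels.zdGraph 3) 0 < Literature.Probability.Percolation.criticalProb ((Literature.Probability.LatticeModels.zdGraph 3).deleteEdges {e | ∃ x : Literature.Probability.LatticeModels.Site 3, (∀ i, (2 ^ k : ℤ) ∣ x i) ∧ e = s(x, x + Pi.single (2 : Fin 3) 1)}) 0) → ∃ S : Set (Sym2 (Literature.Probability.LatticeModels.Site 3)), S ⊆ {e | ∃ x : Literature.Probability.LatticeModels.Site 3, (∀ i, (2 : ℤ) ∣ x i) ∧ e = s(x, x + Pi.single (2 : Fin 3) 1)} ∧ Filter.Tendsto (fun n : ℕ => ((S ∩ ↑(Literature.Probability.LatticeModels.edgesIn (Literature.Probability.LatticeModels.zdGraph 3) (Literature.Probability.LatticeModels.box 3 n))).ncard : ℝ) / ((Literature.Probability.LatticeModels.edgesIn (Literature.Probability.LatticeModels.zdGraph 3) (Literature.Probability.LatticeModels.box 3 n)).card : ℝ)) Filter.atTop (nhds 0) ∧ ∀ᵐ ω ∂(Literature.Probability.Percolation.bondPercolation (Literature.Probability.LatticeModels.zdGraph 3) (Literature.Probability.Percolation.criticalProbI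 3)), ∀ x : Literature.Probability.LatticeModels.Site 3, (Literature.Probability.Percolation.openCluster (ω \ S) x).Finite

/-- item stmt-CriticalPhenomena-9594 · aside · rank 5 · open · by planner
why it might fail: False only if critical Z³ screens sparse periodic defects (δ_k = o(8^{-k}): a removed bond's effective thermal coupling vanishes), implausible but unproved; AG/Menshikov surgery gives δ_k ≥ 8^{-k}e^{-C·2^k} only; linear response = sieve/bulk pivotality comparable at distance 2^k at p_c, d=3: open.
sources: AizenmanGrimmett1991, BalisterBollobasRiordan2014, GrimmettPercolation1999, DuminilcopinKozmaTassion2020, Menshikov1988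
[crux] quantitative Aizenman–Grimmett gain, LINEAR in the sieve density (card crux EffectiveDust
input (a) = needle-threading-strict-diminishment-v2 Q1; re-wants stmt-CriticalPhenomena-7142): there
is c > 0 with p_c(ℤ³ ∖ D_k, 0) ≥ p_c(ℤ³, 0) + c·8^{−k} for all k ≥ 1 (the sieve removes a fraction
8^{−k}/3 of the edges; Bernoulli dilution at density ρ shifts p_c by exactly p_c·ρ/(1−ρ), so the
conjectural truth is δ_k ∼ p_c 8^{−k}/3: periodic and Bernoulli dilution agree to first order at
criticality). Not a hypothesis of `closes`; keys the EFFECTIVE dust (explicit radii) together with a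
DKT-type correlation-length bound (Two-layer plan). [deps: PlugSieveStrictDiminishment] [difficulty:
open-problem] -/
@[route_item "route-CriticalPhenomena-PercDustRigidity"]
def QuantitativeSieveGain : Prop :=
  ∃ c : ℝ, 0 < c ∧ ∀ k : ℕ, 1 ≤ k → Literature.Probability.Percolation.criticalProb (Literature.Probability.LatticeModels.zdGraph 3) 0 + c * ((8 : ℝ) ^ k)⁻¹ ≤ Literature.Probability.Percolation.criticalProb ((Literature.Probability.LatticeModels.zdGraph 3).deleteEdges {e | ∃ x : Literature.Probability.LatticeModels.Site 3, (∀ i, (2 ^ k : ℤ) ∣ x i) ∧ e = s(x, x + Pi.single (2 : Fin 3) 1)}) 0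

/-- item stmt-CriticalPhenomena-11441 · support · rank 9 · closed · proved by Summit.CriticalPhenomena.PercolationContinuityZ3.Theorems.DustRigidityDustGraphPlugSieve.dustGraphPlugSieve_proof @ 8d595f4bdd3a (prover) · by planner
sources: BarskyGrimmettNewman1991, GrimmettPercolation1999, GrimmettMarstrand1990, AizenmanGrimmett1991, ChayesChayesDurrett1987
[support] the card's lower-bracket theorem in GRAPH form, SHARPENED after route review (refuters
g2/g3 on stmt-CriticalPhenomena-9597: with S = ∅, or with the planar cut S₀ = all vertical edges
between two layers — an admissible density-zero matching — the old DustGraphZ3 followed from the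
conjunct resp. from BGN + GM, i.e. was known/degenerate): there is an INFINITE density-zero
sub-family S of the level-1 plug sieve D₁ = {s(x, x+e₃) : x ∈ 2ℤ³} (isolated vertical edges,
pairwise vertex-disjoint, never containing a cut-set since ℤ³ ∖ D₁ is connected) with p_c(ℤ³ ∖ S, 0)
= p_c(ℤ³, 0) and θ_{ℤ³∖S}(x; p_c(ℤ³)) = 0 for all x. Proof plan unchanged: S := ⋃_k (D_k ∩ shell_k)
from PlugSieveStrictDiminishment + the proof of DustDeathOfStrictDiminishment (death at p_c(ℤ³),
density → 0, S infinite), and p_c(ℤ³ ∖ S) ≤ p_c(ℤ³) by a Grimmett–Marstrand slab (PROVED,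
GrimmettMarstrand1990_blocks_holds) placed strictly between two level-K sieve planes z ∈ 2^Kℤ, where
it misses all dust of level ≥ K and meets only finitely many finer dust edges (finite-energy patch);
≥ is θ-monotonicity under deleteEdges. Not a hypothesis of `closes`; supersedes DustGraphZ3
(stmt-CriticalPhenomena-9597, same rank/ki -/
@[route_item "route-CriticalPhenomena-PercDustRigidity"]
def DustGraphPlugSieve : Prop :=
  ∃ S : Set (Sym2 (Literature.Probability.LatticeModels.Site 3)), S ⊆ {e | ∃ x : Literature.Probability.LatticeModels.Site 3, (∀ i, (2 : ℤ) ∣ x i) ∧ e = s(x, x + Pi.single (2 : Fin 3) 1)} ∧ S.Infinite ∧ Filter.Tendsto (fun n : ℕ => ((S ∩ ↑(Literature.Probability.LatticeModels.edgesIn (Literature.Probability.LatticeModels.zdGraph 3) (Literature.Probability.LatticeModels.box 3 n))).ncard : ℝ) / ((Literature.Probability.LatticeModels.edgesIn (Literature.Probability.LatticeModels.zdGraph 3) (Literature.Probability.LatticeModels.box 3 n)).card : ℝ)) Filter.atTop (nhds 0) ∧ Literature.Probability.Percolation.criticalProb ((Literature.Probability.LatticeModels.zdGraph 3).deleteEdges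 S) 0 = Literature.Probability.Percolation.criticalProb (Literature.Probability.LatticeModels.zdGraph 3) 0 ∧ ∀ x : Literature.Probability.LatticeModels.Site 3, Literature.Probability.Percolation.theta ((Literature.Probability.LatticeModels.zdGraph 3).deleteEdges S) x (Literature.Probability.Percolation.criticalProbI 3) = 0

/-- item stmt-CriticalPhenomena-18906 · support · rank 9 · closed · proved by Summit.CriticalPhenomena.PercolationContinuityZ3.Theorems.PercDustRigidityDustRigiditySplitGlue.dustRigiditySplitGlue_proof @ df0ac2543c11 (prover) · by planner
[support] (strategist split glue, BC2 redirect of the deciding crux DustRigidity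
stmt-CriticalPhenomena-9591) NoInfinitelyFragileGiant → SieveCoarsening → DustRigidity: Burton–Keane
uniqueness (ae_numInfiniteClusters_le_one_of_isInsertionTolerantErgodic, fed by (H1)–(H4))
discharges the uniqueness hypothesis of both pieces; the dust clause gives Death(D_1) by
openCluster_mono (S ⊆ D₁ = D_1 after 2^1 = 2); Nat.le_induction on the level with SieveCoarsening
gives Death(D_k) for every k ≥ 1; NoInfinitelyFragileGiant concludes. PROVED sorry-free: theorem
dustRigidity_of_subs in
Summits/CriticalPhenomena/PercolationContinuityZ3/Cruxes/DustRigidity/SplitAssembly.lean (lean check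
rc0, axioms propext/Classical.choice/Quot.sound, ~30 tactic lines, commit ac28e81a6767), landed
verbatim as Theorems/PercDustRigidityDustRigiditySplit.lean with `theorem splitGlue_proof :
DustRigiditySplitGlue := fun h1 h2 => dustRigidity_of_subs h1 h2`. With this item proved,
DustRigidity is DERIVED from the two pieces (the route's `closes` keeps DustRigidity as binder until
a tenure `--split`/re-glue; recommended re-glue: portraits → PlugSieveStrictDiminishment →
SieveDeathAllLevels → NoInfinitelyFragileGiant → -/
@[route_item "route-CriticalPhenomena-PercDustRigidity"]
def DustRigiditySplitGlue : Prop :=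
  NoInfinitelyFragileGiant → SieveCoarsening → DustRigidity

/-- item stmt-CriticalPhenomena-9595 · support · rank 9 · closed · proved by Summit.CriticalPhenomena.PercolationContinuityZ3.Theorems.BernoulliPortrait.bernoulliStationaryPortrait_proof @ c084fc36ffac (prover) · by planner
sources: GrimmettPercolation1999, Harris1960, BurtonKeane1989
[support] Bernoulli(p_c) soft portrait, part 1/2 (clauses 1,2,3,6,7 of PercPotemkinWeaver's
BernoulliSoftPortrait stmt-CriticalPhenomena-4883, verbatim; split in two only because a single item
may not exceed 4000 chars — Sketch3.lean proves part1 ∧ part2 ↔ BernoulliSoftPortrait): P_{p_c} on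
ℤ³ is supported on lattice configurations, translation-invariant, ℤ³-ergodic (invariant events
trivial), ergodic under every single non-zero shift (ergodic_relabel_shift_bondPercolation), and
invariant under every graph automorphism of ℤ³ (BondPercolationSymmetry). Provable now; one proof
serves both routes. [difficulty: provable-now] -/
@[route_item "route-CriticalPhenomena-PercDustRigidity"]
def BernoulliStationaryPortrait : Prop :=
  (∀ᵐ ω ∂(Literature.Probability.Percolation.bondPercolation (Literature.Probability.LatticeModels.zdGraph 3) (Literature.Probability.Percolation.criticalProbI 3)), ω ⊆ (Literature.Probability.LatticeModels.zdGraph 3).edgeSet) ∧ (∀ (v : Literature.Probability.LatticeModels.Site 3) (S : Set (Literature.Probability.Percolation.BondConfig (Literature.Probability.LatticeModels.Site 3))), MeasurableSet S → (Literature.Probability.Percolation.bondPercolation (Literature.Probability.LatticeModels.zdGraph 3) (Literature.Probability.Percolation.criticalProbI 3)) (Literature.Probability.Percolation.BondConfig.relabel (Literature.Probability.Percolation.sym2Equiv (Literature.Probability.LatticeModels.Site.shift v)) ⁻¹' S) = (Literature.Probability.Percolation.bondPercolation (Literature.Probability.LatticeModels.zdGraph 3) (Literature.Probability.Percolation.criticalProbI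 3)) S) ∧ (∀ S : Set (Literature.Probability.Percolation.BondConfig (Literature.Probability.LatticeModels.Site 3)), MeasurableSet S → (∀ v : Literature.Probability.LatticeModels.Site 3, Literature.Probability.Percolation.BondConfig.relabel (Literature.Probability.Percolation.sym2Equiv (Literature.Probability.LatticeModels.Site.shift v)) ⁻¹' S = S) → (Literature.Probability.Percolation.bondPercolation (Literature.Probability.LatticeModels.zdGraph 3) (Literature.Probability.Percolation.criticalProbI 3)) S = 0 ∨ (Literature.Probability.Percolation.bondPercolation (Literature.Probability.LatticeModels.zdGraph 3) (Literature.Probability.Percolation.criticalProbI 3)) S = 1) ∧ (∀ v : Literature.Probability.LatticeModels.Site 3, v ≠ 0 → Ergodic (Literature.Probability.Percolation.BondConfig.relabel (Literature.Probability.Percolation.sym2Equiv (Literature.Probability.LatticeModels.Site.shift v))) (Literature.Probability.Percolation.bondPercolation (Literature.Probability.LatticeModels.zdGraph 3) (Literature.Probability.Percolation.criticalProbI 3))) ∧ (∀ (γ : Literature.Probability.LatticeModels.zdGraph 3 ≃g Literature.Probability.LatticeModels.zdGraph 3) (A : Set (Literature.Probability.Percolation.BondConfig (Literature.Probability.LatticeModels.Site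 3))), MeasurableSet A → (Literature.Probability.Percolation.bondPercolation (Literature.Probability.LatticeModels.zdGraph 3) (Literature.Probability.Percolation.criticalProbI 3)) (Literature.Probability.Percolation.BondConfig.relabel (Literature.Probability.Percolation.sym2Equiv γ.toEquiv) ⁻¹' A) = (Literature.Probability.Percolation.bondPercolation (Literature.Probability.LatticeModels.zdGraph 3) (Literature.Probability.Percolation.criticalProbI 3)) A)

/-- item stmt-CriticalPhenomena-9596 · support · rank 9 · closed · proved by Summit.CriticalPhenomena.PercolationContinuityZ3.Theorems.BernoulliPortrait.bernoulliEnergyFKGPortrait_proof @ ed2cd46fdb94 (prover) · by planner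
sources: BarskyGrimmettNewman1991, GrimmettPercolation1999, Harris1960, AizenmanDuminilCopinSidoraviciusCMP2015
[support] Bernoulli(p_c) soft portrait, part 2/2 (clauses 4,5,8,9 of BernoulliSoftPortrait,
verbatim): insertion tolerance (opening the edges of any box Λ_N costs at most a factor, p_c > 0),
deletion tolerance ((1−p_c)^{|E(Λ_N)|}, p_c < 1: Grimmett1999_criticalProb_pos_lt_one in tree),
positive association (Harris–FKG, harris_fkg_holds), and a.s. finiteness of all coordinate
half-space clusters (BarskyGrimmettNewman1991_Z3_holds at the root of {0 ≤ x_0}; other roots by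
Harris + insertion of a path; other half-spaces by lattice symmetry). Provable now. [difficulty:
provable-now] -/
@[route_item "route-CriticalPhenomena-PercDustRigidity"]
def BernoulliEnergyFKGPortrait : Prop :=
  (∀ N : ℕ, ∃ c : ℝ, 0 < c ∧ ∀ S : Set (Literature.Probability.Percolation.BondConfig (Literature.Probability.LatticeModels.Site 3)), MeasurableSet S → c * (Literature.Probability.Percolation.bondPercolation (Literature.Probability.LatticeModels.zdGraph 3) (Literature.Probability.Percolation.criticalProbI 3)).real ((fun ω : Literature.Probability.Percolation.BondConfig (Literature.Probability.LatticeModels.Site 3) => ω ∪ ↑(Literature.Probability.LatticeModels.edgesIn (Literature.Probability.LatticeModels.zdGraph 3) (Literature.Probability.LatticeModels.box 3 N))) ⁻¹' S) ≤ (Literature.Probability.Percolation.bondPercolation (Literature.Probability.LatticeModels.zdGraph 3) (Literature.Probability.Percolation.criticalProbI 3)).real S) ∧ (∀ N : ℕ, ∃ c : ℝ, 0 < c ∧ ∀ S : Set (Literature.Probability.Percolation.BondConfig (Literature.Probability.LatticeModels.Site 3)), MeasurableSet S → c * (Literature.Probability.Percolation.bondPercolation (Literature.Probability.LatticeModels.zdGraph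 3) (Literature.Probability.Percolation.criticalProbI 3)).real ((fun ω : Literature.Probability.Percolation.BondConfig (Literature.Probability.LatticeModels.Site 3) => ω \ ↑(Literature.Probability.LatticeModels.edgesIn (Literature.Probability.LatticeModels.zdGraph 3) (Literature.Probability.LatticeModels.box 3 N))) ⁻¹' S) ≤ (Literature.Probability.Percolation.bondPercolation (Literature.Probability.LatticeModels.zdGraph 3) (Literature.Probability.Percolation.criticalProbI 3)).real S) ∧ (∀ A B : Set (Literature.Probability.Percolation.BondConfig (Literature.Probability.LatticeModels.Site 3)), IsUpperSet A → IsUpperSet B → MeasurableSet A → MeasurableSet B → (Literature.Probability.Percolation.bondPercolation (Literature.Probability.LatticeModels.zdGraph 3) (Literature.Probability.Percolation.criticalProbI 3)) A * (Literature.Probability.Percolation.bondPercolation (Literature.Probability.LatticeModels.zdGraph 3) (Literature.Probability.Percolation.criticalProbI 3)) B ≤ (Literature.Probability.Percolation.bondPercolation (Literature.Probability.LatticeModels.zdGraph 3) (Literature.Probability.Percolation.criticalProbI 3)) (A ∩ B)) ∧ (∀ᵐ ω ∂(Literature.Probability.Percolation.bondPercolation (Literature.Probability.LatticeModels.zdGraph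 3) (Literature.Probability.Percolation.criticalProbI 3)), ∀ (i : Fin 3) (a : ℤ) (v : Literature.Probability.LatticeModels.Site 3), {y : Literature.Probability.LatticeModels.Site 3 | ω ∈ Literature.Probability.Percolation.openConnIn {x : Literature.Probability.LatticeModels.Site 3 | a ≤ x i} v y}.Finite ∧ {y : Literature.Probability.LatticeModels.Site 3 | ω ∈ Literature.Probability.Percolation.openConnIn {x : Literature.Probability.LatticeModels.Site 3 | x i ≤ a} v y}.Finite)

/-- item stmt-CriticalPhenomena-9598 · assembly · rank 1 · closed · proved by Summit.CriticalPhenomena.PercolationContinuityZ3.Theorems.PercDustRigidityAssembly.assembly_proof @ 1922d85d9809 (prover) · by planner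
sources: GrimmettPercolation1999, BarskyGrimmettNewman1991
[assembly] BernoulliStationaryPortrait → BernoulliEnergyFKGPortrait → PlugSieveStrictDiminishment →
DustDeathOfStrictDiminishment → DustRigidity → PercolationContinuityZ3 (the audited sub-problem
Statement decl `_root_.PercolationContinuityZ3`, by name; D-0027 §2.1; proved as `closes`). -/
@[route_item "route-CriticalPhenomena-PercDustRigidity"]
def Assembly : Prop :=
  BernoulliStationaryPortrait → BernoulliEnergyFKGPortrait → PlugSieveStrictDiminishment → DustDeathOfStrictDiminishment → DustRigidity → _root_.PercolationContinuityZ3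

-- records of items no longer active in this route (dropped / restated):
-- earlier DustGraphZ3 (stmt-CriticalPhenomena-9597, replaced 2026-08-15T17:50:59Z -> stmt-CriticalPhenomena-11441): retired by None — ∃ S : Set (Sym2 (Literature.Probability.LatticeModels.Site 3)), S ⊆ (Literature.Probability.LatticeModels.zdGraph 3).edgeSet ∧ (∀ e ∈ S, ∀ e' ∈ S, e ≠ e' → ∀ v : Literature.Probability.LatticeModels.Site 3, v ∈ e → v ∉ e') ∧ Filter.Tendsto (fun n : ℕ => ((S ∩ ↑(Litera

/-! D-0027 §2.1 — DECIDING THEOREM (planner-authored via `route open/edit --closes-file`; by planner-plancard-CriticalPhenomena-Percolatio-e80b40be-0 2026-08-15T14:03:10Z):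
its hypotheses are this route's items and its conclusion the sub-problem Statement (glue_lint), and it elaborates with this file. -/

@[closes "route-CriticalPhenomena-PercDustRigidity"] theorem closes : BernoulliStationaryPortrait → BernoulliEnergyFKGPortrait → PlugSieveStrictDiminishment → DustDeathOfStrictDiminishment → DustRigidity → _root_.PercolationContinuityZ3 := by
  intro hP1 hP2 hAG hD hR
  obtain ⟨h1, h2, h3, h6, h7⟩ := hP1
  obtain ⟨h4, h5, h8, h9⟩ := hP2
  obtain ⟨S, hS1, hSd, hSdeath⟩ := hD hAG
  have h0 : (Literature.Probability.Percolation.bondPercolation (Literature.Probability.LatticeModels.zdGraph 3) (Literature.Probability.Percolation.criticalProbI 3)) (Literature.Probability.Percolation.percolatesAt (0 : Literature.Probability.LatticeModels.Site 3)) = 0 :=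
    hR _ inferInstance h1 h2 h3 h4 h5 h6 h7 h8 h9 ⟨S, hS1, hSd, hSdeath⟩
  show Literature.Probability.Percolation.theta (Literature.Probability.LatticeModels.zdGraph 3) (0 : Literature.Probability.LatticeModels.Site 3) (Literature.Probability.Percolation.criticalProbI 3) = 0
  simp only [Literature.Probability.Percolation.theta, MeasureTheory.Measure.real, h0, ENNReal.toReal_zero]

end Summit.CriticalPhenomena.PercolationContinuityZ3.Theses.PercDustRigidity
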